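/-
Copyright (c) 2026. All rights reserved.
Released under Apache 2.0 license as described in the file LICENSE.
Authors: HodgeCM publication cell (pub-hodgecm), model-construction sub-cell, discharge seat `mc-discharge-2`.
-/
import Literature.NumberTheory.Weil1964.FiniteWeilLevelFixing
import Literature.NumberTheory.Automorphic.UnitaryGroupArithmeticLevels
import Literature.RepresentationTheory.SeesawScalarCharacter
import HarnessLib

/-!
# Deep principal congruence levels of `U(J)(𝔸_{E,f})` fix `Φ_∞ ⊗ 𝟙_{x₀ + 𝔫𝒪̂^ι}` under a TWISTED Weil action

Topic `NumberTheory/Weil1964`; namespace `Literature.NumberTheory.Weil1964`. REPRODUCTION (folklore level of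
[Weil1964, Chap. III n° 37–39] / [GelbartRogawski1991, §3.1] / [MoeglinVignerasWaldspurger1987, Ch. 2 I.3–I.4]):
kernel only, 0 records, 0 named facts.

THE STATEMENT. Let `s : U(J)(𝔸_{E,f}) →* Mp_ψ(W_𝔸)ᶜᵒⁿᵗ` be a continuous homomorphism whose symplectic components fix
the archimedean vectors (`harch`), `T` invertible, and let `χ : U(J)(𝔸_{E,f}) →* ℂˣ` be a character continuous at `1`
(in the intended use: the see-saw renormalisation character `λ_V` of scheme (small),
`GelbartRogawski1991/UnitaryDualPairSeesawSchemeSmall.charV₁₂`, read on the finite-adelic points). Then for every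
FINITE family of thin cosets `(x₀(a) + 𝔫(a)𝒪̂^ι)_a` there is ONE ideal `𝔪 ≠ 0` of `𝓞_E` such that for every `k` in the
principal finite congruence level `K_{U,f}(𝔪)`:

* `χ k = 1` (`K_{U,f}(𝔪) ≤ ker χ`: no small subgroups in `ℂˣ`, `UnitaryGroup.exists_finCongruenceLevel_le_ker`);
* `ω(s k)(Φ_∞ ⊗ 𝟙_{x₀(a)+𝔫(a)𝒪̂^ι}) = Φ_∞ ⊗ 𝟙_{x₀(a)+𝔫(a)𝒪̂^ι}` for EVERY archimedean factor `Φ_∞` and every `a`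
  (`FiniteWeilLevelFixing.exists_finCongruenceLevel_forall_forall_finRepMp_cosetIndicatorSB_eq_self` +
  `AdelicMetaplecticFinRep.omega_thinCosetTestFunₗ_eq_self`);
* hence the TWISTED action `(twist χ (ω ∘ s)) k = χ(k) • ω(s k)` (`SeesawScalar.twist`) FIXES every
  `Φ_∞ ⊗ 𝟙_{x₀(a)+𝔫(a)𝒪̂^ι}`

(`exists_finCongruenceLevel_le_ker_forall_omega_thinCosetTestFunₗ_eq_self`,
`exists_finCongruenceLevel_forall_twist_omega_thinCosetTestFunₗ_eq_self`). The conclusion is inherited by every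
DEEPER level: all `K_{U,f}(𝔪')`, `0 ≠ 𝔪' ≤ 𝔪` (`finCongruenceLevel_mono`), in particular all INTEGER levels
`K_{U,f}(M𝓞_E)` with `M` a non-zero multiple of `n₀ := N(𝔪)` (`…_forall_dvd_…`: "every `M` divisible by `n₀`").

USE (pub-hodgecm, model layer, binder `C` of the E term, fields (W-Kf′) `fixN` / (Θ-sat) `sat`): the line Weil
action of record is `ω_{P k} = twist (charSmall_k) (ω ∘ pairSmall_k s_k)` (scheme (small) of
`UnitaryDualPairSeesawSchemeSmall`); at a finite-adelic `k_f` embedded as `(1_∞, k_f)` the twist character is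
`λ_V(k_f)` (continuous, `continuous_charV₁₂`) and `harch` holds because the archimedean component is `1`; the present
file then says that the finite `K`-type `K₂ := K_{U,f}(M)`, `n₀ ∣ M`, fixes every `φ_N(Φ_∞) = Φ_∞ ⊗ 𝟙_{x₀+N𝒪̂}`.
Nothing here is specific to that use: the statements are about an arbitrary continuous `s` with `harch` and an
arbitrary `χ` continuous at `1`.

## References

* [Weil1964] A. Weil, *Sur certains groupes d'opérateurs unitaires*, Acta Math. 111 (1964), Chap. III n° 37–39
  pp. 187–190 (`Mp(X)_A` acts continuously on `𝒮(X_A)`; local factors of the standard operators).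
* [GelbartRogawski1991] S. Gelbart, J. Rogawski, *L-functions and Fourier–Jacobi coefficients for the unitary group
  U(3)*, Invent. Math. 105 (1991), §3.1 p. 454 (smooth vectors of the Weil representation restricted to unitary
  groups), Remark p. 457 (splittings differ by a character).
* [MoeglinVignerasWaldspurger1987] C. Mœglin, M.-F. Vignéras, J.-L. Waldspurger, *Correspondances de Howe sur un corps
  p-adique*, LNM 1291 (1987), Chap. 2 I.3–I.4 (every vector of the Weil representation is fixed by a compact open
  subgroup).
* [PlatonovRapinchuk1994] V. Platonov, A. Rapinchuk, *Algebraic Groups and Number Theory* (1994), §5.1 (principal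
  congruence subgroups of `G(𝔸_f)` form a base of neighbourhoods of `1`).
-/

noncomputable section

open scoped Matrix TensorProduct Topology SchwartzMap Classical

open NumberField NumberField.mixedEmbedding IsDedekindDomain Filter

namespace Literature.NumberTheory.Weil1964

open Literature.NumberTheory.Automorphic Literature.RepresentationTheory

/-! ## §1. Twists along pulled-back characters (bookkeeping) -/

section Twist

variable {R : Type*} [Field R] {G G' : Type*} [Monoid G] [Monoid G'] {V : Type*} [AddCommGroup V] [Module R V]

/-- A twisted representation fixes a vector at `g` as soon as the character is `1` at `g` and the untwisted operator
fixes it. [folklore] -/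
theorem twist_apply_eq_self_of_eq_one {χ : G →* Rˣ} (ρ : Representation R G V) {g : G} (hχ : χ g = 1) {v : V}
    (hv : ρ g v = v) : SeesawScalar.twist χ ρ g v = v := by
  rw [SeesawScalar.twist_apply, hχ, Units.val_one, one_smul, hv]

/-- Twisting commutes with pulling back along a homomorphism `f : G' →* G`:
`twist (χ ∘ f) (ρ ∘ f) g' = twist χ ρ (f g')`. [folklore] -/
theorem twist_comp_apply (χ : G →* Rˣ) (ρ : Representation R G V) (f : G' →* G) (g' : G') :
    SeesawScalar.twist (χ.comp f) (ρ.comp f) g' = SeesawScalar.twist χ ρ (f g') := rfl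

end Twist

/-! ## §2. One deep level killing the character AND fixing finitely many thin-coset test functions -/

section Unitary

variable {F : Type} [Field F] [NumberField F] {ι : Type} [Fintype ι] [DecidableEq ι]
  {T : Matrix ι ι (AdeleRing (𝓞 F) F)}
variable {F₁ E : Type} [Field F₁] [Field E] [NumberField E] [Algebra F₁ E] {c : E ≃ₐ[F₁] E} {N : ℕ}
  {J : Matrix (Fin N) (Fin N) E}

/-- **One principal congruence level for a character and finitely many coset test vectors.** For a continuous
homomorphism `s : U(J)(𝔸_{E,f}) →* Mp_ψ(W_𝔸)ᶜᵒⁿᵗ` whose symplectic components fix the archimedean vectors, `T`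
invertible, a character `χ : U(J)(𝔸_{E,f}) →* ℂˣ` continuous at `1`, and a finite family `(x₀(a), 𝔫(a))_a`: there is
`𝔪 ≠ 0` with `K_{U,f}(𝔪) ≤ ker χ` and `ω(s k)(Φ_∞ ⊗ 𝟙_{x₀(a)+𝔫(a)𝒪̂^ι}) = Φ_∞ ⊗ 𝟙_{x₀(a)+𝔫(a)𝒪̂^ι}` for all
`k ∈ K_{U,f}(𝔪)`, all `a` and all `Φ_∞` (intersect the level killing `χ`, `UnitaryGroup.exists_finCongruenceLevel_le_ker`,
with the level fixing the coset indicators, `exists_finCongruenceLevel_forall_forall_finRepMp_cosetIndicatorSB_eq_self`;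
a finite intersection of levels is a neighbourhood of `1` and contains a level, `UnitaryGroup.exists_finCongruenceLevel_subset`).
[cite: GelbartRogawski1991, §3.1 p. 454; MoeglinVignerasWaldspurger1987, Chap. 2 I.3] -/
theorem exists_finCongruenceLevel_le_ker_forall_omega_thinCosetTestFunₗ_eq_self {A : Type*} [Finite A]
    (hT : IsUnit T) (s : UnitaryGroup.finAdelic F₁ E c N J →* adelicMpCont F ι T) (hs : Continuous s)
    (harch : ∀ (k : UnitaryGroup.finAdelic F₁ E c N J) (a w : ι → mixedSpace F),
      (adelicMpCont.proj F ι T (s k)).1 (archVec F ι a, archVec F ι w) = (archVec F ι a, archVec F ι w))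
    (χ : UnitaryGroup.finAdelic F₁ E c N J →* ℂˣ) (hχ : ContinuousAt χ 1)
    (x₀ : A → ι → FiniteAdeleRing (𝓞 F) F) (𝔫 : A → Ideal (𝓞 F)) :
    ∃ 𝔪 : Ideal (𝓞 E), 𝔪 ≠ 0 ∧ UnitaryGroup.finCongruenceLevel F₁ E c N J 𝔪 ≤ χ.ker ∧
      ∀ a, ∀ k ∈ UnitaryGroup.finCongruenceLevel F₁ E c N J 𝔪, ∀ Φ : 𝓢((ι → mixedSpace F), ℂ),
        adelicMpCont.omega F ι T (s k) (thinCosetTestFunₗ (K := F) (ι := ι) (x₀ a) (𝔫 a) Φ) =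
          thinCosetTestFunₗ (K := F) (ι := ι) (x₀ a) (𝔫 a) Φ := by
  -- a level killing `χ`
  -- (`have` first throughout: `obtain … := <application>` trips a slow `isDefEq` in `generalize` here)
  have hexχ := UnitaryGroup.exists_finCongruenceLevel_le_ker χ hχ
  obtain ⟨𝔪₁, h𝔪₁, hker⟩ := hexχ
  -- a level fixing the finitely many coset indicators under the finite factor `ω_f`
  have hex := exists_finCongruenceLevel_forall_forall_finRepMp_cosetIndicatorSB_eq_self hT s hs harch x₀ 𝔫
  obtain ⟨𝔪₂, h𝔪₂, hfix⟩ := hex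
  -- a level inside both
  have hU : ((UnitaryGroup.finCongruenceLevel F₁ E c N J 𝔪₁ : Set (UnitaryGroup.finAdelic F₁ E c N J)) ∩
      (UnitaryGroup.finCongruenceLevel F₁ E c N J 𝔪₂ : Set (UnitaryGroup.finAdelic F₁ E c N J))) ∈
        𝓝 (1 : UnitaryGroup.finAdelic F₁ E c N J) :=
    Filter.inter_mem (UnitaryGroup.finCongruenceLevel_mem_nhds_one h𝔪₁)
      (UnitaryGroup.finCongruenceLevel_mem_nhds_one h𝔪₂)
  have hexU := UnitaryGroup.exists_finCongruenceLevel_subset hU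
  obtain ⟨𝔪, h𝔪, hsub⟩ := hexU
  refine ⟨𝔪, h𝔪, fun k hk => hker (hsub hk).1, fun a k hk Φ => ?_⟩
  exact omega_thinCosetTestFunₗ_eq_self hT s harch k (x₀ a) (𝔫 a) (hfix a k (hsub hk).2) Φ

/-- **Deep principal congruence levels fix `Φ_∞ ⊗ 𝟙_{x₀+𝔫𝒪̂^ι}` under the TWISTED Weil action.** With `s`, `χ`,
`(x₀(a), 𝔫(a))_a` as above there is `𝔪 ≠ 0` such that `(twist χ (ω ∘ s)) k = χ(k) • ω(s k)` fixes every
`Φ_∞ ⊗ 𝟙_{x₀(a)+𝔫(a)𝒪̂^ι}` for every `k ∈ K_{U,f}(𝔪)`. [cite: GelbartRogawski1991, §3.1 p. 454, Remark p. 457] -/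
theorem exists_finCongruenceLevel_forall_twist_omega_thinCosetTestFunₗ_eq_self {A : Type*} [Finite A]
    (hT : IsUnit T) (s : UnitaryGroup.finAdelic F₁ E c N J →* adelicMpCont F ι T) (hs : Continuous s)
    (harch : ∀ (k : UnitaryGroup.finAdelic F₁ E c N J) (a w : ι → mixedSpace F),
      (adelicMpCont.proj F ι T (s k)).1 (archVec F ι a, archVec F ι w) = (archVec F ι a, archVec F ι w))
    (χ : UnitaryGroup.finAdelic F₁ E c N J →* ℂˣ) (hχ : ContinuousAt χ 1)
    (x₀ : A → ι → FiniteAdeleRing (𝓞 F) F) (𝔫 : A → Ideal (𝓞 F)) :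
    ∃ 𝔪 : Ideal (𝓞 E), 𝔪 ≠ 0 ∧
      ∀ a, ∀ k ∈ UnitaryGroup.finCongruenceLevel F₁ E c N J 𝔪, ∀ Φ : 𝓢((ι → mixedSpace F), ℂ),
        SeesawScalar.twist χ ((adelicMpCont.omega F ι T).comp s) k (thinCosetTestFunₗ (K := F) (ι := ι) (x₀ a) (𝔫 a) Φ) =
          thinCosetTestFunₗ (K := F) (ι := ι) (x₀ a) (𝔫 a) Φ := by
  have hex := exists_finCongruenceLevel_le_ker_forall_omega_thinCosetTestFunₗ_eq_self hT s hs harch χ hχ x₀ 𝔫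
  obtain ⟨𝔪, h𝔪, hker, hfix⟩ := hex
  exact ⟨𝔪, h𝔪, fun a k hk Φ =>
    twist_apply_eq_self_of_eq_one _ ((MonoidHom.mem_ker).1 (hker hk)) (hfix a k hk Φ)⟩

/-- **Every deeper level inherits it**: with `𝔪` as above, for every ideal `0 ≠ 𝔪' ≤ 𝔪` and every `k ∈ K_{U,f}(𝔪')`
the twisted action fixes every `Φ_∞ ⊗ 𝟙_{x₀(a)+𝔫(a)𝒪̂^ι}` (`finCongruenceLevel_mono`). [folklore] -/
theorem exists_finCongruenceLevel_forall_le_forall_twist_omega_thinCosetTestFunₗ_eq_self {A : Type*} [Finite A]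
    (hT : IsUnit T) (s : UnitaryGroup.finAdelic F₁ E c N J →* adelicMpCont F ι T) (hs : Continuous s)
    (harch : ∀ (k : UnitaryGroup.finAdelic F₁ E c N J) (a w : ι → mixedSpace F),
      (adelicMpCont.proj F ι T (s k)).1 (archVec F ι a, archVec F ι w) = (archVec F ι a, archVec F ι w))
    (χ : UnitaryGroup.finAdelic F₁ E c N J →* ℂˣ) (hχ : ContinuousAt χ 1)
    (x₀ : A → ι → FiniteAdeleRing (𝓞 F) F) (𝔫 : A → Ideal (𝓞 F)) :
    ∃ 𝔪 : Ideal (𝓞 E), 𝔪 ≠ 0 ∧ ∀ 𝔪' : Ideal (𝓞 E), 𝔪' ≠ 0 → 𝔪' ≤ 𝔪 →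
      ∀ a, ∀ k ∈ UnitaryGroup.finCongruenceLevel F₁ E c N J 𝔪', ∀ Φ : 𝓢((ι → mixedSpace F), ℂ),
        SeesawScalar.twist χ ((adelicMpCont.omega F ι T).comp s) k (thinCosetTestFunₗ (K := F) (ι := ι) (x₀ a) (𝔫 a) Φ) =
          thinCosetTestFunₗ (K := F) (ι := ι) (x₀ a) (𝔫 a) Φ := by
  have hex := exists_finCongruenceLevel_forall_twist_omega_thinCosetTestFunₗ_eq_self hT s hs harch χ hχ x₀ 𝔫
  obtain ⟨𝔪, h𝔪, hfix⟩ := hex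
  exact ⟨𝔪, h𝔪, fun 𝔪' h𝔪' hle a k hk Φ => hfix a k (UnitaryGroup.finCongruenceLevel_mono h𝔪' hle hk) Φ⟩

/-- **Integer-level form ("every `M` divisible by `n₀`").** With `s`, `χ`, `(x₀(a), 𝔫(a))_a` as above there is a
natural number `n₀ ≠ 0` such that for every non-zero multiple `M` of `n₀` and every `k` in the principal congruence
level `K_{U,f}(M𝓞_E)`: `χ k = 1` and `ω(s k)` — hence also the twisted operator `χ(k) • ω(s k)` — fixes every
`Φ_∞ ⊗ 𝟙_{x₀(a)+𝔫(a)𝒪̂^ι}` (`n₀ := N(𝔪)`; `K_{U,f}(M𝓞_E) ≤ K_{U,f}(n₀𝓞_E) ≤ K_{U,f}(𝔪)`,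
`finCongruenceLevel_span_absNorm_le`, `finCongruenceLevel_mono`). [cite: GelbartRogawski1991, §3.1 p. 454;
PlatonovRapinchuk1994, §5.1] -/
theorem exists_nat_forall_dvd_finCongruenceLevel_forall_omega_thinCosetTestFunₗ_eq_self {A : Type*} [Finite A]
    (hT : IsUnit T) (s : UnitaryGroup.finAdelic F₁ E c N J →* adelicMpCont F ι T) (hs : Continuous s)
    (harch : ∀ (k : UnitaryGroup.finAdelic F₁ E c N J) (a w : ι → mixedSpace F),
      (adelicMpCont.proj F ι T (s k)).1 (archVec F ι a, archVec F ι w) = (archVec F ι a, archVec F ι w))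
    (χ : UnitaryGroup.finAdelic F₁ E c N J →* ℂˣ) (hχ : ContinuousAt χ 1)
    (x₀ : A → ι → FiniteAdeleRing (𝓞 F) F) (𝔫 : A → Ideal (𝓞 F)) :
    ∃ n₀ : ℕ, n₀ ≠ 0 ∧ ∀ M : ℕ, M ≠ 0 → n₀ ∣ M →
      ∀ k ∈ UnitaryGroup.finCongruenceLevel F₁ E c N J (Ideal.span {(M : 𝓞 E)}),
        χ k = 1 ∧ ∀ a, ∀ Φ : 𝓢((ι → mixedSpace F), ℂ),
          adelicMpCont.omega F ι T (s k) (thinCosetTestFunₗ (K := F) (ι := ι) (x₀ a) (𝔫 a) Φ) =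
              thinCosetTestFunₗ (K := F) (ι := ι) (x₀ a) (𝔫 a) Φ ∧
            SeesawScalar.twist χ ((adelicMpCont.omega F ι T).comp s) k (thinCosetTestFunₗ (K := F) (ι := ι) (x₀ a) (𝔫 a) Φ) =
              thinCosetTestFunₗ (K := F) (ι := ι) (x₀ a) (𝔫 a) Φ := by
  have hex := exists_finCongruenceLevel_le_ker_forall_omega_thinCosetTestFunₗ_eq_self hT s hs harch χ hχ x₀ 𝔫
  obtain ⟨𝔪, h𝔪, hker, hfix⟩ := hex
  refine ⟨Ideal.absNorm 𝔪, Ideal.absNorm_eq_zero_iff.not.2 (by rwa [← Ideal.zero_eq_bot]), fun M hM hdvd k hk => ?_⟩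
  -- `K_{U,f}(M𝓞_E) ≤ K_{U,f}(N(𝔪)𝓞_E) ≤ K_{U,f}(𝔪)`
  have hM0 : Ideal.span {(M : 𝓞 E)} ≠ 0 := by
    rw [Ne, Ideal.zero_eq_bot, Ideal.span_singleton_eq_bot]
    exact_mod_cast hM
  have hle : Ideal.span {(M : 𝓞 E)} ≤ Ideal.span {((Ideal.absNorm 𝔪 : ℕ) : 𝓞 E)} := by
    rw [Ideal.span_singleton_le_span_singleton]
    exact Nat.cast_dvd_cast hdvd
  have hk' : k ∈ UnitaryGroup.finCongruenceLevel F₁ E c N J 𝔪 :=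
    UnitaryGroup.finCongruenceLevel_span_absNorm_le h𝔪 (UnitaryGroup.finCongruenceLevel_mono hM0 hle hk)
  have hχk : χ k = 1 := (MonoidHom.mem_ker).1 (hker hk')
  exact ⟨hχk, fun a Φ => ⟨hfix a k hk' Φ, twist_apply_eq_self_of_eq_one _ hχk (hfix a k hk' Φ)⟩⟩

/-- **Single-coset, untwisted corollary in `hfix`/`fixN` shape**: for ONE thin coset `x₀ + 𝔫𝒪̂^ι` there is `n₀ ≠ 0`
such that every `k ∈ K_{U,f}(M𝓞_E)`, `M` a non-zero multiple of `n₀`, satisfies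
`ω(s k)(Φ_∞ ⊗ 𝟙_{x₀+𝔫𝒪̂^ι}) = Φ_∞ ⊗ 𝟙_{x₀+𝔫𝒪̂^ι}` for every `Φ_∞`. [cite: GelbartRogawski1991, §3.1 p. 454] -/
theorem exists_nat_forall_dvd_finCongruenceLevel_forall_omega_thinCosetTestFunₗ_eq_self₁
    (hT : IsUnit T) (s : UnitaryGroup.finAdelic F₁ E c N J →* adelicMpCont F ι T) (hs : Continuous s)
    (harch : ∀ (k : UnitaryGroup.finAdelic F₁ E c N J) (a w : ι → mixedSpace F),
      (adelicMpCont.proj F ι T (s k)).1 (archVec F ι a, archVec F ι w) = (archVec F ι a, archVec F ι w))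
    (x₀ : ι → FiniteAdeleRing (𝓞 F) F) (𝔫 : Ideal (𝓞 F)) :
    ∃ n₀ : ℕ, n₀ ≠ 0 ∧ ∀ M : ℕ, M ≠ 0 → n₀ ∣ M →
      ∀ k ∈ UnitaryGroup.finCongruenceLevel F₁ E c N J (Ideal.span {(M : 𝓞 E)}),
        ∀ Φ : 𝓢((ι → mixedSpace F), ℂ),
          adelicMpCont.omega F ι T (s k) (thinCosetTestFunₗ (K := F) (ι := ι) x₀ 𝔫 Φ) =
            thinCosetTestFunₗ (K := F) (ι := ι) x₀ 𝔫 Φ := by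
  have hex := exists_nat_forall_dvd_finCongruenceLevel_forall_omega_thinCosetTestFunₗ_eq_self
    (A := Unit) hT s hs harch (1 : UnitaryGroup.finAdelic F₁ E c N J →* ℂˣ) continuousAt_const (fun _ => x₀)
    (fun _ => 𝔫)
  obtain ⟨n₀, hn₀, h⟩ := hex
  exact ⟨n₀, hn₀, fun M hM hdvd k hk Φ => ((h M hM hdvd k hk).2 () Φ).1⟩

end Unitary

end Literature.NumberTheory.Weil1964
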